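import Literature.MathematicalPhysics.QuantumLattice.InfVolFermionStateGaugeAction
import Literature.MathematicalPhysics.QuantumLattice.InfVolFermionStateGaugeCommutator
import Literature.MathematicalPhysics.QuantumLattice.TranslationInvariantStatePairLRO
import Literature.MathematicalPhysics.QuantumLattice.ErgodicStatesODLRO
import Literature.MathematicalPhysics.QuantumLattice.ErgodicStatesODLROProofs
import HarnessLib

/-!
# `m* > 0` ⟹ a gauge-SYMMETRIC translation-invariant infinite-volume ground state of the `t–t'`
# Hubbard pencil with zero pair amplitude and `d`-wave long-range order `≥ (m*)²`; the pair amplitudes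
# of the ground states fill the closed disc of radius `m*`

Topic `Literature/MathematicalPhysics/QuantumLattice` (namespace = path). Seat `hubbard-cq-p4` (cell
`pub/hubbard-cq`, row "finite-h Kennedy–Lieb–Shastry / Koma–Tasaki dictionary lemmas the transplant /
dual lenses need"); transplant-1 DICTIONARY v2 §10 BN-T4 (a) as a theorem, and the «full `U(1)`
orbit» item of `DWaveOrderParameterSymmetricRange.lean`. Everything is PROVED (no definition, no named
fact; one corollary is stated modulo the tree's named fact `ergodic_pairCorr_boxAverage` — and, in the closing
section, unconditionally, that fact being discharged by `ergodic_pairCorr_boxAverage_holds`), zero compute.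

Inputs: `TranslationInvariantStatePairLRO.lean` (every translation-invariant state:
`N⁴‖ω(P_0)‖² ≤ Re Σ_{x,y∈[0,N)²} ω(P_x⋆P_y)`; the quasi-average ground state has ODLRO `≥ (m*)²`),
`InfVolFermionStateGaugeAction.lean` (gauge transforms / gauge average of states; the `t–t'–U–μ`
pencil is gauge invariant, so ground states go to ground states; `ω̄(P_x) = 0`),
`DWaveOrderParameterQuasiAverageState.lean` (hubbard-cq-p5: `Re ω(P₀^d) ≤ m*` for every
translation-invariant ground state, `= m*` attained).

## What is proved (`m* = dWaveOrderParameterTT' t' U μ`; ground state = mean-energy minimiser of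
`hubbardTTPrimeMuInteraction 1 t' U μ`, range `1`; `P_x^d = localPairAt ({0} ∪ unitSteps) dWaveFormFactor x`)

* `expect_gaugeAut_of_isNParticle`, `torusAvgExpect_gaugeAut`, **`IsTorusLimitOf.isGaugeInvariant`**
  — in a fixed-particle-number vector `⟨ψ, γ_θ(B) ψ⟩ = ⟨ψ, B ψ⟩`, so TORUS LIMITS OF FIXED-PARTICLE-NUMBER
  FAMILIES (e.g. of the summit's sector ground states `ψ_L`) ARE GAUGE-INVARIANT STATES (twin of
  `IsTorusLimitOf.isEven`); in particular they have zero pair amplitude.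
* `InfVolFermionState.gaugeShift_pairCorr`, `gaugeAverage_pairCorr` — the pair two-point function
  `ω(P_x⋆ P_y)` (charge `0`) is unchanged by gauge transforms and by the gauge average.
* **`exists_gaugeInvariant_isMeanEnergyMinimiser_dWaveOrderParameterTT'_sq_le_re_boxAverage`** — THE
  SYMMETRIC LRO STATE: some `ω̄` is (i) a translation-invariant ground state, (ii) gauge invariant,
  (iii) `ω̄(P_x^d) = 0` for all `x`, (iv) `(m*)² ≤ Re N⁻⁴ Σ_{x,y∈[0,N)²} ω̄(P_x^d⋆ P_y^d)` for all `N ≥ 1`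
  (the gauge average of Koma–Tasaki's quasi-average state).  Positive-`m*` forms:
  `exists_gaugeInvariant_isMeanEnergyMinimiser_odlro_of_hasDWaveOrderTT'` and the `t' = 0` twin
  `…_of_hasDWaveOrder` (strictly positive `N`-uniform ODLRO floor, zero amplitude); and, modulo
  `ergodic_pairCorr_boxAverage` (Bratteli–Robinson I Thm. 4.3.17),
  `exists_gaugeInvariant_isMeanEnergyMinimiser_not_isErgodic_of_hasDWaveOrderTT'`: this symmetric ground
  state is NOT translation-ergodic (Sewell / Fannes–Pule–Verbeure: its ergodic components break the
  gauge symmetry); and **BN-T4 (b) modulo `[U]`**: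
  `IsMeanEnergyMinimiser.dWaveOrderParameterTT'_sq_le_re_boxAverage_of_unique_symmetric` — IF the
  gauge-symmetric translation-invariant ground state is unique, EVERY symmetric translation-invariant
  ground state has ODLRO `≥ (m*)²` in every box; torus-limit form
  `IsTorusLimitOf.dWaveOrderParameterTT'_sq_le_re_boxAverage_of_unique_symmetric` (transplant-1's T: every
  torus limit of unit fixed-`N` ground vectors of `dWaveSourceTorusTT' L t' U μ 0`, modulo `[U]`).
* **`IsMeanEnergyMinimiser.norm_expect_localPairAt_le_dWaveOrderParameterTT'`** — every
  translation-invariant ground state has `|ω(P₀^d)| ≤ m*` (rotate by `γ_{arg/2}`), and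
  **`image_expect_localPairAt_groundStates_eq_closedBall`** — the set of pair amplitudes
  `{ω(P₀^d) : ω ground state}` IS the closed disc `{|z| ≤ m*}` (circle by gauge transforms of the
  quasi-average state, interior by mixing antipodes); `t' = 0` twin `…_eq_closedBall_zero`.

## Honest placement (cell `hubbard-cq`, census (24)/(27)/(31), transplant-1 BN-T3/T4, obst-1 BN7)
This is the RESPONSE ⇒ LRO direction, but only in the INFINITE-VOLUME class: `ω̄` is built from the
weak-⋆ limit `h → 0⁺` AFTER `L → ∞`. Whether the SYMMETRIC TORUS ground states `ψ_L` of the summit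
statement converge to `ω̄` (uniqueness `[U]` of the symmetric translation-invariant ground state) and
whether fixed-box LRO passes to the torus diagonal (`[BN7]`) are untouched — so this is a dictionary
theorem (T5 class), not a floor instrument, and it does not bear on `HubbardSuperconductivity` without
`[U] ∧ [BN7]`. The converse (LRO ⇒ `m* > 0`, Koma–Tasaki 1993 Thm. 7.3) is the tree's
`le_dWaveOrderParameter_of_pairLRO` family.

## References
* T. Koma, H. Tasaki, J. Stat. Phys. 76 (1994) 745–803, §1 (order parameters, quasi-average states,
  symmetry breaking vs. long-range order in infinite volume). [cite: KomaTasaki1994, §1]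
* G. L. Sewell, J. Math. Phys. 11 (1970) 1868, §4 (ODLRO of states of the quasi-local algebra).
  [cite: Sewell1970, §4]
* O. Bratteli, D. W. Robinson, *OAQSM 1* (1987), Thm. 4.3.17 (ergodic states); *OAQSM 2* (1997) §5.2.2
  (gauge group). [cite: BratteliRobinsonI1987, Thm. 4.3.17] [cite: BratteliRobinsonII1997, §5.2.2]
* R. B. Griffiths, Phys. Rev. 152 (1966) 240, §II (convexity / symmetric range of the order parameter).
  [cite: Griffiths1966, §II]
-/

noncomputable section

namespace Literature.MathematicalPhysics.QuantumLattice

open _root_.Matrix Finset Complex Literature.LinearAlgebra.Matrix Literature.Probability.LatticeModels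
  _root_.Filter Set
open scoped _root_.Topology ComplexOrder

/-! ### Torus limits of fixed-particle-number families are gauge invariant -/

section TorusLimits

variable {d : ℕ}

/-- `e^{iθN̂} ψ = e^{iθN} ψ` on an `N`-particle vector. [cite: Tasaki2020, §9.2] -/
theorem fockGaugeU1_mulVec_of_isNParticle {ι : Type*} [LinearOrder ι] [Fintype ι] {N : ℕ} {ψ : Fock ι}
    (hψ : IsNParticle N ψ) (θ : ℝ) : fockGaugeU1 θ *ᵥ ψ = exp (I * θ * N) • ψ := by
  ext s
  rw [fockGaugeU1, Matrix.mulVec_diagonal, Pi.smul_apply, smul_eq_mul]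
  by_cases hs : s.card = N
  · rw [hs]
  · rw [hψ s hs, mul_zero, mul_zero]

/-- **In an `N`-particle vector the expectations of `γ_θ B` and `B` agree** (`e^{iθN̂} ψ = e^{iθN} ψ`
and `|e^{iθN}| = 1`). [cite: BratteliRobinsonII1997, §5.2.2] -/
theorem expect_gaugeAut_of_isNParticle {ι : Type*} [LinearOrder ι] [Fintype ι] {N : ℕ} {ψ : Fock ι}
    (hψ : IsNParticle N ψ) (θ : ℝ) (B : Matrix (Finset ι) (Finset ι) ℂ) :
    expect (gaugeAut θ B) ψ = expect B ψ := by
  rw [gaugeAut_apply, expect, expect, ← Matrix.mulVec_mulVec, ← Matrix.mulVec_mulVec,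
    conjTranspose_fockGaugeU1, fockGaugeU1_mulVec_of_isNParticle hψ, Matrix.mulVec_smul,
    Matrix.dotProduct_mulVec, ← Matrix.conjTranspose_conjTranspose (fockGaugeU1 θ), ← Matrix.star_mulVec,
    conjTranspose_fockGaugeU1, fockGaugeU1_mulVec_of_isNParticle hψ, star_smul, dotProduct_smul,
    smul_dotProduct, smul_smul]
  have h1 : exp (I * ((-θ : ℝ) : ℂ) * N) * star (exp (I * ((-θ : ℝ) : ℂ) * N)) = 1 := by
    rw [Complex.star_def, Complex.mul_conj, Complex.normSq_eq_norm_sq, Complex.norm_exp]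
    simp
  rw [h1, one_smul]

/-- **The averaged torus expectations of an `N`-particle vector are gauge invariant**: `γ_θ A` and
`A` have the same value (the translates `U_v ψ` are again `N`-particle vectors and `Γ` commutes with
`γ_θ`). [cite: BratteliRobinsonII1997, §5.2.2] -/
theorem torusAvgExpectAt_gaugeAut (L : ℕ) [NeZero L] (Λ : Finset (Site d)) (A : FermionOp Λ) (θ : ℝ)
    {N : ℕ} {ψ : Fock (Orb (FermionTorus d L))} (hψ : IsNParticle N ψ) :
    torusAvgExpectAt L Λ (gaugeAut θ A) ψ = torusAvgExpectAt L Λ A ψ := by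
  by_cases h : Set.InjOn (Torus.proj (d := d) L) ↑Λ
  · rw [torusAvgExpectAt_of_injOn L h, torusAvgExpectAt_of_injOn L h, fermionEmbed_gaugeAut]
    refine congrArg (fun z : ℂ => ((Fintype.card (TorusSite d L) : ℂ))⁻¹ * z) ?_
    refine Finset.sum_congr rfl fun v _ => ?_
    exact expect_gaugeAut_of_isNParticle (hψ.fockRelabel_mulVec _) θ _
  · rw [torusAvgExpectAt_of_not_injOn L h, torusAvgExpectAt_of_not_injOn L h]

/-- `torusAvgExpectAt_gaugeAut` for arbitrary side. [cite: BratteliRobinsonII1997, §5.2.2] -/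
theorem torusAvgExpect_gaugeAut (L : ℕ) (Λ : Finset (Site d)) (A : FermionOp Λ) (θ : ℝ) {N : ℕ}
    {ψ : Fock (Orb (FermionTorus d L))} (hψ : IsNParticle N ψ) :
    torusAvgExpect L Λ (gaugeAut θ A) ψ = torusAvgExpect L Λ A ψ := by
  rcases Nat.eq_zero_or_pos L with rfl | hL
  · rw [torusAvgExpect_zero, torusAvgExpect_zero]
  · haveI : NeZero L := NeZero.of_pos hL
    rw [torusAvgExpect_eq, torusAvgExpect_eq, torusAvgExpectAt_gaugeAut L Λ A θ hψ]

/-- **Torus limits of fixed-particle-number families are GAUGE-INVARIANT (symmetric) states** — in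
particular the infinite-volume limits of the summit's sector ground states `ψ_L` have zero pair
amplitude `ω(P_x) = 0` (`IsGaugeInvariant.expect_localPairAt_eq_zero`). Twin of
`IsTorusLimitOf.isEven`. [cite: BratteliRobinsonII1997, §5.2.2] -/
theorem InfVolFermionState.IsTorusLimitOf.isGaugeInvariant {ω : InfVolFermionState d}
    {ψ : ∀ L, Fock (Orb (FermionTorus d L))} {Ls : ℕ → ℕ} (h : ω.IsTorusLimitOf ψ Ls) {N : ℕ → ℕ}
    (hψ : ∀ j, IsNParticle (N j) (ψ (Ls j))) : ω.IsGaugeInvariant := by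
  intro θ
  refine InfVolFermionState.ext fun Λ => LinearMap.ext fun A => ?_
  rw [InfVolFermionState.gaugeShift_expect]
  refine tendsto_nhds_unique (h Λ (gaugeAut θ A)) ?_
  have heq : (fun j => torusAvgExpect (Ls j) Λ (gaugeAut θ A) (ψ (Ls j))) =
      fun j => torusAvgExpect (Ls j) Λ A (ψ (Ls j)) :=
    funext fun j => torusAvgExpect_gaugeAut _ Λ A θ (hψ j)
  rw [heq]
  exact h Λ A

/-- The same with the particle number prescribed at every side `L` (the summit's families
`N_L = 2⌊(1−δ)L²/2⌋`). [cite: BratteliRobinsonII1997, §5.2.2] -/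
theorem InfVolFermionState.IsTorusLimitOf.isGaugeInvariant' {ω : InfVolFermionState d}
    {ψ : ∀ L, Fock (Orb (FermionTorus d L))} {Ls : ℕ → ℕ} (h : ω.IsTorusLimitOf ψ Ls) {N : ℕ → ℕ}
    (hψ : ∀ L, IsNParticle (N L) (ψ L)) : ω.IsGaugeInvariant :=
  h.isGaugeInvariant (N := fun j => N (Ls j)) fun j => hψ (Ls j)

end TorusLimits

namespace InfVolFermionState

/-! ### The pair two-point function is gauge invariant -/

/-- `Γ(P_x)⋆ Γ(P_y)` has charge `0`. [cite: BratteliRobinsonII1997, §5.2.2] -/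
theorem hasGaugeCharge_zero_localPairAt_conjTranspose_mul (S : Finset (Site 2)) (g : Site 2 → ℝ)
    (x y : Site 2) {Λ : Finset (Site 2)} (hx : pairRegion S x ⊆ Λ) (hy : pairRegion S y ⊆ Λ) :
    HasGaugeCharge 0 (fermionEmbed (PolySite.incl hx) (localPairAt S g x)ᴴ *
      fermionEmbed (PolySite.incl hy) (localPairAt S g y)) := by
  have h := (((hasGaugeCharge_localPairAt S g x).fermionEmbed (PolySite.incl hx)).conjTranspose).mul
    ((hasGaugeCharge_localPairAt S g y).fermionEmbed (PolySite.incl hy))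
  rw [← fermionEmbed_conjTranspose] at h
  norm_num at h
  exact h

/-- **The pair two-point function is unchanged by the gauge transforms**: `(ω∘γ_θ)(P_x⋆P_y) = ω(P_x⋆P_y)`.
[cite: Sewell1970, §4] -/
theorem gaugeShift_pairCorr (ω : InfVolFermionState 2) (θ : ℝ) (S : Finset (Site 2)) (g : Site 2 → ℝ)
    (x y : Site 2) : (ω.gaugeShift θ).pairCorr S g x y = ω.pairCorr S g x y := by
  rw [pairCorr, pairCorr, corr_eq, corr_eq, gaugeShift_expect,
    (hasGaugeCharge_zero_localPairAt_conjTranspose_mul S g x y _ _).gaugeAut_eq]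

/-- **The pair two-point function is unchanged by the gauge AVERAGE**: `ω̄(P_x⋆P_y) = ω(P_x⋆P_y)`.
[cite: Sewell1970, §4] -/
theorem gaugeAverage_pairCorr (ω : InfVolFermionState 2) (S : Finset (Site 2)) (g : Site 2 → ℝ)
    (x y : Site 2) : ω.gaugeAverage.pairCorr S g x y = ω.pairCorr S g x y := by
  rw [pairCorr, pairCorr, corr_eq, corr_eq,
    gaugeAverage_expect_of_hasGaugeCharge_zero _ (hasGaugeCharge_zero_localPairAt_conjTranspose_mul S g x y _ _)]

/-- `d`-wave form. [cite: Sewell1970, §4] -/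
theorem gaugeAverage_dWavePairCorr (ω : InfVolFermionState 2) (x y : Site 2) :
    ω.gaugeAverage.dWavePairCorr x y = ω.dWavePairCorr x y :=
  gaugeAverage_pairCorr ω _ _ x y

end InfVolFermionState

/-! ### The gauge-SYMMETRIC ground state with `d`-wave long-range order -/

section Symmetric

open InfVolFermionState

variable (t' U μ : ℝ)

/-- **`m* > 0` ⟹ A GAUGE-SYMMETRIC TRANSLATION-INVARIANT GROUND STATE WITH `d`-WAVE LONG-RANGE ORDER
`≥ (m*)²`** (transplant-1 DICTIONARY v2 §10, BN-T4 (a), as a theorem): for every `(t', U, μ)` there is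
an infinite-volume state `ω̄` which (i) is a translation-invariant mean-energy minimiser (ground state)
of the grand-canonical `t–t'` Hubbard interaction `hubbardTTPrimeMuInteraction 1 t' U μ`, (ii) is
`U(1)`-GAUGE INVARIANT (`ω̄ ∘ γ_θ = ω̄`), hence (iii) has ZERO pair amplitude `ω̄(P_x^d) = 0` at every
site, and yet (iv) carries `d`-wave off-diagonal long-range order at least the SQUARE OF THE ORDER
PARAMETER, uniformly in the box: `(m*)² ≤ Re N⁻⁴ Σ_{x,y∈[0,N)²} ω̄(P_x^d⋆ P_y^d)` for every `N ≥ 1`,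
`m* = dWaveOrderParameterTT' t' U μ`.  `ω̄` is the gauge average of Koma–Tasaki's quasi-average state
(`Re ω(P₀^d) = m*`): averaging kills the amplitude, preserves the ground-state property (the
interaction is gauge invariant) and the gauge-invariant two-point function, whose box sums the
amplitude floors (`TranslationInvariantStatePairLRO.lean`).  Direction RESPONSE ⇒ LRO for a
SYMMETRIC state — in the infinite-volume class; nothing about the torus ground states.
[cite: KomaTasaki1994, §1] [cite: Sewell1970, §4] -/
theorem exists_gaugeInvariant_isMeanEnergyMinimiser_dWaveOrderParameterTT'_sq_le_re_boxAverage :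
    ∃ ω : InfVolFermionState 2, ω.IsMeanEnergyMinimiser (hubbardTTPrimeMuInteraction 1 t' U μ) 1 ∧
      ω.IsGaugeInvariant ∧
      (∀ x : Site 2, ω.expect (pairRegion (insert (0 : Site 2) unitSteps) x)
        (localPairAt (insert 0 unitSteps) dWaveFormFactor x) = 0) ∧
      ∀ N : ℕ, N ≠ 0 → dWaveOrderParameterTT' t' U μ ^ 2 ≤
        (((N : ℂ) ^ 4)⁻¹ * ∑ x ∈ halfOpenBox 2 N, ∑ y ∈ halfOpenBox 2 N, ω.dWavePairCorr x y).re := by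
  obtain ⟨ω, hω, -, hlro⟩ :=
    exists_isMeanEnergyMinimiser_dWaveOrderParameterTT'_sq_le_re_boxAverage_dWavePairCorr t' U μ
  refine ⟨ω.gaugeAverage, hω.gaugeAverage (hubbardTTPrimeMuInteraction_isGaugeInvariant 1 t' U μ),
    ω.gaugeAverage_isGaugeInvariant, fun x => ω.gaugeAverage_expect_localPairAt _ _ x, fun N hN => ?_⟩
  simp only [gaugeAverage_dWavePairCorr]
  exact hlro N hN

/-- **`HasDWaveOrderTT' t' U μ` ⟹ a gauge-symmetric translation-invariant infinite-volume ground state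
with zero pair amplitude and a strictly positive `N`-uniform `d`-wave ODLRO floor exists.**
[cite: KomaTasaki1994, §1] [cite: Sewell1970, §4] -/
theorem exists_gaugeInvariant_isMeanEnergyMinimiser_odlro_of_hasDWaveOrderTT' {t' U μ : ℝ}
    (h : HasDWaveOrderTT' t' U μ) :
    ∃ ω : InfVolFermionState 2, ω.IsMeanEnergyMinimiser (hubbardTTPrimeMuInteraction 1 t' U μ) 1 ∧
      ω.IsGaugeInvariant ∧
      (∀ x : Site 2, ω.expect (pairRegion (insert (0 : Site 2) unitSteps) x)
        (localPairAt (insert 0 unitSteps) dWaveFormFactor x) = 0) ∧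
      ∃ c : ℝ, 0 < c ∧ ∀ N : ℕ, N ≠ 0 →
        c ≤ (((N : ℂ) ^ 4)⁻¹ * ∑ x ∈ halfOpenBox 2 N, ∑ y ∈ halfOpenBox 2 N, ω.dWavePairCorr x y).re := by
  obtain ⟨ω, hω, hinv, h0, hlro⟩ :=
    exists_gaugeInvariant_isMeanEnergyMinimiser_dWaveOrderParameterTT'_sq_le_re_boxAverage t' U μ
  exact ⟨ω, hω, hinv, h0, dWaveOrderParameterTT' t' U μ ^ 2, pow_pos h 2, hlro⟩

/-- **`t' = 0`**: `HasDWaveOrder U μ` ⟹ a gauge-symmetric translation-invariant ground state of the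
grand-canonical pure Hubbard interaction with zero pair amplitude and strictly positive ODLRO exists.
[cite: KomaTasaki1994, §1] -/
theorem exists_gaugeInvariant_isMeanEnergyMinimiser_odlro_of_hasDWaveOrder {U μ : ℝ} (h : HasDWaveOrder U μ) :
    ∃ ω : InfVolFermionState 2, ω.IsMeanEnergyMinimiser (hubbardTTPrimeMuInteraction 1 0 U μ) 1 ∧
      ω.IsGaugeInvariant ∧
      (∀ x : Site 2, ω.expect (pairRegion (insert (0 : Site 2) unitSteps) x)
        (localPairAt (insert 0 unitSteps) dWaveFormFactor x) = 0) ∧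
      ∃ c : ℝ, 0 < c ∧ ∀ N : ℕ, N ≠ 0 →
        c ≤ (((N : ℂ) ^ 4)⁻¹ * ∑ x ∈ halfOpenBox 2 N, ∑ y ∈ halfOpenBox 2 N, ω.dWavePairCorr x y).re :=
  exists_gaugeInvariant_isMeanEnergyMinimiser_odlro_of_hasDWaveOrderTT' ((hasDWaveOrderTT'_zero_iff U μ).2 h)

/-- **… and (modulo the ergodic box-average fact, Bratteli–Robinson I Thm. 4.3.17 = the tree's named
fact `ergodic_pairCorr_boxAverage`) this symmetric ground state is NOT translation-ergodic** — its
ergodic components must break the gauge symmetry (Sewell 1970 §4 / Fannes–Pule–Verbeure 1982, via the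
tree's `not_isErgodic_of_odlro`). [cite: Sewell1970, §4] [cite: BratteliRobinsonI1987, Thm. 4.3.17] -/
theorem exists_gaugeInvariant_isMeanEnergyMinimiser_not_isErgodic_of_hasDWaveOrderTT'
    (herg : InfVolFermionState.ergodic_pairCorr_boxAverage) {t' U μ : ℝ} (h : HasDWaveOrderTT' t' U μ) :
    ∃ ω : InfVolFermionState 2, ω.IsMeanEnergyMinimiser (hubbardTTPrimeMuInteraction 1 t' U μ) 1 ∧
      ω.IsGaugeInvariant ∧ ¬ ω.IsErgodic := by
  obtain ⟨ω, hω, hinv, h0, c, hc, hlro⟩ := exists_gaugeInvariant_isMeanEnergyMinimiser_odlro_of_hasDWaveOrderTT' h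
  refine ⟨ω, hω, hinv, not_isErgodic_of_odlro herg (h0 0) hc ?_⟩
  filter_upwards [eventually_ne_atTop 0] with N hN
  exact hlro N hN

/-- **BN-T4 (b) modulo uniqueness**: if the gauge-SYMMETRIC translation-invariant ground state of the
`t–t'` Hubbard pencil is UNIQUE (hypothesis `[U]` of transplant-1's DICTIONARY v2 §10 — not an energy,
not certifiable, physically open at finite doping), then EVERY gauge-invariant translation-invariant
ground state (in particular, by `IsTorusLimitOf.isGaugeInvariant`, every torus limit of
fixed-particle-number ground-state vectors that is a ground state of the pencil) carries `d`-wave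
ODLRO `≥ (m*)²` uniformly in the box. The remaining passage to the torus diagonal of the summit
statement is obst-1's BN7 and is NOT addressed. [cite: KomaTasaki1994, §1] [cite: Sewell1970, §4] -/
theorem InfVolFermionState.IsMeanEnergyMinimiser.dWaveOrderParameterTT'_sq_le_re_boxAverage_of_unique_symmetric
    (hU : ∀ ω₁ ω₂ : InfVolFermionState 2,
      ω₁.IsMeanEnergyMinimiser (hubbardTTPrimeMuInteraction 1 t' U μ) 1 → ω₁.IsGaugeInvariant →
      ω₂.IsMeanEnergyMinimiser (hubbardTTPrimeMuInteraction 1 t' U μ) 1 → ω₂.IsGaugeInvariant → ω₁ = ω₂)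
    {ω : InfVolFermionState 2} (hω : ω.IsMeanEnergyMinimiser (hubbardTTPrimeMuInteraction 1 t' U μ) 1)
    (hinv : ω.IsGaugeInvariant) {N : ℕ} (hN : N ≠ 0) :
    dWaveOrderParameterTT' t' U μ ^ 2 ≤
      (((N : ℂ) ^ 4)⁻¹ * ∑ x ∈ halfOpenBox 2 N, ∑ y ∈ halfOpenBox 2 N, ω.dWavePairCorr x y).re := by
  obtain ⟨ω', hω', hinv', -, hlro⟩ :=
    exists_gaugeInvariant_isMeanEnergyMinimiser_dWaveOrderParameterTT'_sq_le_re_boxAverage t' U μ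
  rw [hU ω ω' hω hinv hω' hinv']
  exact hlro N hN

/-- **T (transplant-1 DICTIONARY v3 §11), the torus-limit corollary modulo `[U]`**: under uniqueness of
the gauge-symmetric translation-invariant ground state, EVERY torus limit (along sides `Ls → ∞`) of
unit, fixed-particle-number ground-state vectors of the source-free grand-canonical `t–t'` Hubbard tori
`dWaveSourceTorusTT' L t' U μ 0 = H_L − μN_L` carries `d`-wave ODLRO `≥ (m*)²` in every box — such a
limit is translation invariant, a mean-energy minimiser (obsth-2's
`IsTorusLimitOf.isMeanEnergyMinimiser_sourced` at `h = 0`) and gauge invariant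
(`IsTorusLimitOf.isGaugeInvariant`). The torus-DIAGONAL pair structure factor of the finite tori (the
summit's object) is NOT controlled (BN7). [cite: KomaTasaki1994, §1] [cite: Sewell1970, §4] -/
theorem InfVolFermionState.IsTorusLimitOf.dWaveOrderParameterTT'_sq_le_re_boxAverage_of_unique_symmetric
    (hU : ∀ ω₁ ω₂ : InfVolFermionState 2,
      ω₁.IsMeanEnergyMinimiser (hubbardTTPrimeMuInteraction 1 t' U μ) 1 → ω₁.IsGaugeInvariant →
      ω₂.IsMeanEnergyMinimiser (hubbardTTPrimeMuInteraction 1 t' U μ) 1 → ω₂.IsGaugeInvariant → ω₁ = ω₂)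
    {ψ : ∀ L, Fock (Orb (FermionTorus 2 L))} {Ls : ℕ → ℕ} {N : ℕ → ℕ} {ω : InfVolFermionState 2}
    [∀ j, NeZero (Ls j)] (hω : ω.IsTorusLimitOf ψ Ls) (hLs : Tendsto Ls atTop atTop)
    (hunit : ∀ j, star (ψ (Ls j)) ⬝ᵥ ψ (Ls j) = 1) (hN : ∀ j, IsNParticle (N j) (ψ (Ls j)))
    (hgs : ∀ j, dWaveSourceTorusTT' (Ls j) t' U μ 0 *ᵥ ψ (Ls j) =
      ((Matrix.groundEnergy (dWaveSourceTorusTT' (Ls j) t' U μ 0) : ℝ) : ℂ) • ψ (Ls j))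
    {n : ℕ} (hn : n ≠ 0) :
    dWaveOrderParameterTT' t' U μ ^ 2 ≤
      (((n : ℂ) ^ 4)⁻¹ * ∑ x ∈ halfOpenBox 2 n, ∑ y ∈ halfOpenBox 2 n, ω.dWavePairCorr x y).re := by
  have hmin := hω.isMeanEnergyMinimiser_sourced hLs hunit t' U μ 0 hgs
  rw [hubbardTTPrimeSourcedInteraction_zero_source] at hmin
  exact hmin.dWaveOrderParameterTT'_sq_le_re_boxAverage_of_unique_symmetric t' U μ hU
    (hω.isGaugeInvariant hN) hn

end Symmetric

/-! ### The full `U(1)` orbit: the pair amplitudes of the ground states fill the closed disc of radius `m*` -/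

section Orbit

open InfVolFermionState

variable (t' U μ : ℝ)

/-- **Every translation-invariant ground state has `|ω(P₀^d)| ≤ m*`** (not only `Re ω(P₀^d) ≤ m*`):
rotate by the gauge transform `γ_θ`, `θ = arg ω(P₀^d)/2`, which makes the amplitude real and
non-negative and is again a ground state. Closes the «full `U(1)` orbit» item left open in
`DWaveOrderParameterSymmetricRange.lean`. [cite: KomaTasaki1994, §1] -/
theorem InfVolFermionState.IsMeanEnergyMinimiser.norm_expect_localPairAt_le_dWaveOrderParameterTT'
    {ω : InfVolFermionState 2} (hω : ω.IsMeanEnergyMinimiser (hubbardTTPrimeMuInteraction 1 t' U μ) 1) :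
    ‖ω.expect (pairRegion (insert (0 : Site 2) unitSteps) 0)
        (localPairAt (insert 0 unitSteps) dWaveFormFactor 0)‖ ≤ dWaveOrderParameterTT' t' U μ := by
  set a : ℂ := ω.expect (pairRegion (insert (0 : Site 2) unitSteps) 0)
    (localPairAt (insert 0 unitSteps) dWaveFormFactor 0) with ha
  set θ : ℝ := Complex.arg a / 2 with hθ
  have hrot := (hω.gaugeShift (hubbardTTPrimeMuInteraction_isGaugeInvariant 1 t' U μ)
    θ).re_expect_localPairAt_le_dWaveOrderParameterTT'
  rw [gaugeShift_expect_localPairAt, ← ha] at hrot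
  have hphase : exp (-(2 * (I * (θ : ℂ)))) * a = (‖a‖ : ℂ) := by
    have h1 : (‖a‖ : ℂ) * exp (Complex.arg a * I) = a := Complex.norm_mul_exp_arg_mul_I a
    have h2 : -(2 * (I * (θ : ℂ))) = -(Complex.arg a * I) := by
      rw [hθ]; push_cast; ring
    calc exp (-(2 * (I * (θ : ℂ)))) * a = exp (-(Complex.arg a * I)) * ((‖a‖ : ℂ) * exp (Complex.arg a * I)) := by
          rw [h2]; congr 1; exact h1.symm
      _ = (‖a‖ : ℂ) * (exp (-(Complex.arg a * I)) * exp (Complex.arg a * I)) := by ring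
      _ = (‖a‖ : ℂ) := by rw [← Complex.exp_add, neg_add_cancel, Complex.exp_zero, mul_one]
  rw [hphase, Complex.ofReal_re] at hrot
  exact hrot

/-- **THE PAIR AMPLITUDES OF THE TRANSLATION-INVARIANT GROUND STATES FILL EXACTLY THE CLOSED DISC OF
RADIUS `m*`**: `{ω(P₀^d) : ω ground state} = {z : |z| ≤ dWaveOrderParameterTT' t' U μ}` — `⊆` by the
previous bound; `⊇`: the quasi-average state has amplitude exactly `m*` (real, since
`Re = m* ≥ |·|`), its gauge transforms realise the circle `m* e^{iφ}`, and mixing antipodal points of the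
circle (minimisers are convex) fills the disc. [cite: KomaTasaki1994, §1] [cite: Griffiths1966, §II] -/
theorem image_expect_localPairAt_groundStates_eq_closedBall :
    (fun ω : InfVolFermionState 2 => ω.expect (pairRegion (insert (0 : Site 2) unitSteps) 0)
        (localPairAt (insert 0 unitSteps) dWaveFormFactor 0)) ''
        {ω | ω.IsMeanEnergyMinimiser (hubbardTTPrimeMuInteraction 1 t' U μ) 1} =
      Metric.closedBall (0 : ℂ) (dWaveOrderParameterTT' t' U μ) := by
  set m : ℝ := dWaveOrderParameterTT' t' U μ with hm
  have hΨ := hubbardTTPrimeMuInteraction_isGaugeInvariant 1 t' U μ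
  ext z
  simp only [Set.mem_image, Set.mem_setOf_eq, Metric.mem_closedBall, dist_zero_right]
  constructor
  · rintro ⟨ω, hω, rfl⟩
    exact hω.norm_expect_localPairAt_le_dWaveOrderParameterTT'
  · intro hz
    -- the quasi-average state: amplitude exactly `m` (as a complex number)
    obtain ⟨ω, hω, hωre⟩ := exists_isMeanEnergyMinimiser_re_expect_localPairAt_eq_dWaveOrderParameterTT' t' U μ
    set a : ℂ := ω.expect (pairRegion (insert (0 : Site 2) unitSteps) 0)
      (localPairAt (insert 0 unitSteps) dWaveFormFactor 0) with ha
    have hnorm : ‖a‖ ≤ m := hω.norm_expect_localPairAt_le_dWaveOrderParameterTT'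
    have haim : a.im = 0 := by
      have h1 : a.re ^ 2 + a.im ^ 2 = ‖a‖ ^ 2 := by
        rw [Complex.sq_norm, Complex.normSq_apply]; ring
      have h2 : ‖a‖ ^ 2 ≤ a.re ^ 2 := by
        rw [hωre]
        exact pow_le_pow_left₀ (norm_nonneg _) hnorm 2
      nlinarith [sq_nonneg a.im]
    have haeq : a = (m : ℂ) := Complex.ext (by rw [hωre, Complex.ofReal_re]) (by rw [haim, Complex.ofReal_im])
    by_cases hm0 : m = 0
    · -- then `z = 0`: the gauge average does it
      have hz0 : z = 0 := by rw [hm0] at hz; exact norm_le_zero_iff.1 hz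
      refine ⟨ω.gaugeAverage, hω.gaugeAverage hΨ, ?_⟩
      rw [hz0]
      exact ω.gaugeAverage_expect_localPairAt _ _ 0
    · have hmpos : 0 < m := lt_of_le_of_ne (dWaveOrderParameterTT'_nonneg t' U μ) (Ne.symm hm0)
      -- rotate to the direction of `z` and mix with the antipode
      set θ : ℝ := -(Complex.arg z / 2) with hθ
      set t : ℝ := (1 + ‖z‖ / m) / 2 with ht
      have ht₀ : 0 ≤ t := by rw [ht]; positivity
      have ht₁ : t ≤ 1 := by
        rw [ht]
        have : ‖z‖ / m ≤ 1 := (div_le_one hmpos).2 hz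
        linarith
      refine ⟨InfVolFermionState.mix t ht₀ ht₁ (ω.gaugeShift θ) (ω.gaugeShift (θ + Real.pi / 2)),
        (hω.gaugeShift hΨ θ).mix (hω.gaugeShift hΨ _) t ht₀ ht₁, ?_⟩
      rw [mix_expect, gaugeShift_expect_localPairAt, gaugeShift_expect_localPairAt, ← ha, haeq]
      have hrot : exp (-(2 * (I * ((θ + Real.pi / 2 : ℝ) : ℂ)))) = -exp (-(2 * (I * (θ : ℂ)))) := by
        rw [show -(2 * (I * ((θ + Real.pi / 2 : ℝ) : ℂ))) = -(2 * (I * (θ : ℂ))) + -Real.pi * I by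
          push_cast; ring, Complex.exp_add, show (-Real.pi : ℂ) * I = -(Real.pi * I) by ring,
          Complex.exp_neg (Real.pi * I), Complex.exp_pi_mul_I]
        norm_num
      rw [hrot]
      have hphase : exp (-(2 * (I * (θ : ℂ)))) = exp (Complex.arg z * I) := by
        congr 1; rw [hθ]; push_cast; ring
      rw [hphase]
      have hzpolar : (‖z‖ : ℂ) * exp (Complex.arg z * I) = z := Complex.norm_mul_exp_arg_mul_I z
      have hcoef : (t : ℂ) * m + ((1 - t : ℝ) : ℂ) * (-m) = (‖z‖ : ℂ) := by
        have hm0' : (m : ℂ) ≠ 0 := by exact_mod_cast hm0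
        rw [ht]; push_cast; field_simp; ring
      calc (t : ℂ) * (exp (Complex.arg z * I) * m) + ((1 - t : ℝ) : ℂ) * (-exp (Complex.arg z * I) * m)
          = ((t : ℂ) * m + ((1 - t : ℝ) : ℂ) * (-m)) * exp (Complex.arg z * I) := by ring
        _ = z := by rw [hcoef, hzpolar]

/-- `t' = 0` form of the disc theorem. [cite: KomaTasaki1994, §1] -/
theorem image_expect_localPairAt_groundStates_eq_closedBall_zero (U μ : ℝ) :
    (fun ω : InfVolFermionState 2 => ω.expect (pairRegion (insert (0 : Site 2) unitSteps) 0)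
        (localPairAt (insert 0 unitSteps) dWaveFormFactor 0)) ''
        {ω | ω.IsMeanEnergyMinimiser (hubbardTTPrimeMuInteraction 1 0 U μ) 1} =
      Metric.closedBall (0 : ℂ) (dWaveOrderParameter U μ) := by
  rw [← dWaveOrderParameterTT'_zero]
  exact image_expect_localPairAt_groundStates_eq_closedBall 0 U μ

end Orbit

/-! ### Corollaries of the disc theorem: order, and its absence, in terms of the ground-state amplitudes -/

section OrderIff

open InfVolFermionState

variable (t' U μ : ℝ)

/-- **No order `⟺` every translation-invariant ground state has zero pair amplitude**:
`dWaveOrderParameterTT' t' U μ = 0 ↔ ∀ ω` (mean-energy minimiser of `hubbardTTPrimeMuInteraction 1 t' U μ`),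
`ω(P₀^d) = 0` (as a complex number; the disc of amplitudes has radius `m*`).
[cite: KomaTasaki1994, §1] -/
theorem dWaveOrderParameterTT'_eq_zero_iff_forall_expect_localPairAt_eq_zero :
    dWaveOrderParameterTT' t' U μ = 0 ↔ ∀ ω : InfVolFermionState 2,
      ω.IsMeanEnergyMinimiser (hubbardTTPrimeMuInteraction 1 t' U μ) 1 →
        ω.expect (pairRegion (insert (0 : Site 2) unitSteps) 0)
          (localPairAt (insert 0 unitSteps) dWaveFormFactor 0) = 0 := by
  constructor
  · intro h0 ω hω
    have h := hω.norm_expect_localPairAt_le_dWaveOrderParameterTT' t' U μ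
    rw [h0] at h
    exact norm_le_zero_iff.1 h
  · intro h
    obtain ⟨ω, hω, hωe⟩ := exists_isMeanEnergyMinimiser_re_expect_localPairAt_eq_dWaveOrderParameterTT' t' U μ
    rw [← hωe, h ω hω, Complex.zero_re]

/-- **Order `⟺` some translation-invariant ground state has NON-ZERO (complex) pair amplitude**:
`HasDWaveOrderTT' t' U μ ↔ ∃ ω` ground state with `ω(P₀^d) ≠ 0` (any phase). Upgrades hubbard-cq-p5's
`hasDWaveOrderTT'_iff_exists_isMeanEnergyMinimiser` (`0 < Re ω(P₀^d)`) to the full `U(1)` orbit.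
[cite: KomaTasaki1994, §1] -/
theorem hasDWaveOrderTT'_iff_exists_expect_localPairAt_ne_zero :
    HasDWaveOrderTT' t' U μ ↔ ∃ ω : InfVolFermionState 2,
      ω.IsMeanEnergyMinimiser (hubbardTTPrimeMuInteraction 1 t' U μ) 1 ∧
        ω.expect (pairRegion (insert (0 : Site 2) unitSteps) 0)
          (localPairAt (insert 0 unitSteps) dWaveFormFactor 0) ≠ 0 := by
  constructor
  · intro h
    obtain ⟨ω, hω, hpos⟩ := (hasDWaveOrderTT'_iff_exists_isMeanEnergyMinimiser t' U μ).1 h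
    refine ⟨ω, hω, fun h0 => ?_⟩
    rw [h0, Complex.zero_re] at hpos
    exact lt_irrefl _ hpos
  · rintro ⟨ω, hω, hne⟩
    have h := hω.norm_expect_localPairAt_le_dWaveOrderParameterTT' t' U μ
    exact lt_of_lt_of_le (norm_pos_iff.2 hne) h

/-- **No order `⟺` every translation-invariant ground state is indistinguishable from a gauge-symmetric
one ON THE PAIR AMPLITUDE** — stated as: `¬ HasDWaveOrderTT' ↔` all ground-state pair amplitudes vanish.
[cite: KomaTasaki1994, §1] -/
theorem not_hasDWaveOrderTT'_iff_forall_expect_localPairAt_eq_zero :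
    ¬ HasDWaveOrderTT' t' U μ ↔ ∀ ω : InfVolFermionState 2,
      ω.IsMeanEnergyMinimiser (hubbardTTPrimeMuInteraction 1 t' U μ) 1 →
        ω.expect (pairRegion (insert (0 : Site 2) unitSteps) 0)
          (localPairAt (insert 0 unitSteps) dWaveFormFactor 0) = 0 := by
  rw [hasDWaveOrderTT'_iff_exists_expect_localPairAt_ne_zero]
  push Not
  rfl

end OrderIff

/-! ### The dual form of T2 (dual-2 DUALITY-MEMO v3 §J (J4)): `m₁ ≤ m*` iff an EXACT translation-invariant
ground state with pair amplitude `≥ m₁` exists; torus limits of fixed-`N` families satisfy the charge rows -/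

section DualT2

open InfVolFermionState

variable (t' U μ : ℝ)

/-- **T2 in dual form (dual-2 §J (J4))**: `m₁ ≤ dWaveOrderParameterTT' t' U μ` iff there EXISTS a
translation-invariant ground state (exact mean-energy minimiser of `hubbardTTPrimeMuInteraction 1 t' U μ`) with
`m₁ ≤ Re ω(P₀^d)` — `⇒` by Koma–Tasaki's quasi-average state (`Re ω₊(P₀^d) = m*`), `⇐` by the variational
bound `Re ω(P₀^d) ≤ m*` of every translation-invariant ground state (hubbard-cq-p5). The witness must be an
EXACT ground state: any energy excess only yields the T1 envelope. [cite: KomaTasaki1994, §1] -/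
theorem le_dWaveOrderParameterTT'_iff_exists_isMeanEnergyMinimiser_le_re (m₁ : ℝ) :
    m₁ ≤ dWaveOrderParameterTT' t' U μ ↔ ∃ ω : InfVolFermionState 2,
      ω.IsMeanEnergyMinimiser (hubbardTTPrimeMuInteraction 1 t' U μ) 1 ∧
        m₁ ≤ (ω.expect (pairRegion (insert (0 : Site 2) unitSteps) 0)
          (localPairAt (insert 0 unitSteps) dWaveFormFactor 0)).re := by
  constructor
  · intro h
    obtain ⟨ω, hω, hωe⟩ := exists_isMeanEnergyMinimiser_re_expect_localPairAt_eq_dWaveOrderParameterTT' t' U μ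
    exact ⟨ω, hω, hωe ▸ h⟩
  · rintro ⟨ω, hω, hm⟩
    exact hm.trans hω.re_expect_localPairAt_le_dWaveOrderParameterTT'

/-- The same with the MODULUS of the (complex) pair amplitude: `m₁ ≤ m* ↔ ∃` translation-invariant ground
state with `m₁ ≤ |ω(P₀^d)|` (full `U(1)` orbit). [cite: KomaTasaki1994, §1] -/
theorem le_dWaveOrderParameterTT'_iff_exists_isMeanEnergyMinimiser_le_norm (m₁ : ℝ) :
    m₁ ≤ dWaveOrderParameterTT' t' U μ ↔ ∃ ω : InfVolFermionState 2,
      ω.IsMeanEnergyMinimiser (hubbardTTPrimeMuInteraction 1 t' U μ) 1 ∧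
        m₁ ≤ ‖ω.expect (pairRegion (insert (0 : Site 2) unitSteps) 0)
          (localPairAt (insert 0 unitSteps) dWaveFormFactor 0)‖ := by
  constructor
  · intro h
    obtain ⟨ω, hω, hωe⟩ := exists_isMeanEnergyMinimiser_re_expect_localPairAt_eq_dWaveOrderParameterTT' t' U μ
    exact ⟨ω, hω, (hωe ▸ h).trans (Complex.re_le_norm _)⟩
  · rintro ⟨ω, hω, hm⟩
    exact hm.trans (hω.norm_expect_localPairAt_le_dWaveOrderParameterTT' t' U μ)

end DualT2

section TorusLimitChargeRows

variable {d : ℕ}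

/-- **Torus limits of fixed-particle-number families satisfy every CHARGE ROW**: `ω_Λ(N̂_Λ A − A N̂_Λ) = 0` for
all regions `Λ` and local `A` (they are gauge invariant, `IsTorusLimitOf.isGaugeInvariant`, and gauge
invariance is this commutator condition, `isGaugeInvariant_iff_forall_expect_commutator`) — the form in which a
KKT / Ward–Bogoliubov certificate consumer (`Rows/SourcedTorusRows*Hook`, `commDensity` blocks) imposes the
`U(1)` symmetry on the limit states of the summit's sector ground states. [cite: BratteliRobinsonII1997, §5.2.2] -/
theorem InfVolFermionState.IsTorusLimitOf.expect_commutator_totalNumberOp_eq_zero {ω : InfVolFermionState d}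
    {ψ : ∀ L, Fock (Orb (FermionTorus d L))} {Ls : ℕ → ℕ} (h : ω.IsTorusLimitOf ψ Ls) {N : ℕ → ℕ}
    (hψ : ∀ j, IsNParticle (N j) (ψ (Ls j))) (Λ : Finset (Site d)) (A : FermionOp Λ) :
    ω.expect Λ ((totalNumberOp : FermionOp Λ) * A - A * (totalNumberOp : FermionOp Λ)) = 0 :=
  (h.isGaugeInvariant hψ).expect_commutator_totalNumberOp Λ A

end TorusLimitChargeRows

section TorusLimitAmplitude

variable {d : ℕ}

/-- **Torus limits of fixed-particle-number families have ZERO pair amplitude**: for every torus limit `ω`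
(along any sides `Ls`) of vectors `ψ_L` with definite particle number — in particular of the summit's
sector ground states — `ω(P_x) = 0` for every local singlet pair (any step set and form factor). Hence the
`T2` witness «a translation-invariant ground state with `Re ω(P₀^d) > 0`»
(`hasDWaveOrderTT'_iff_exists_isMeanEnergyMinimiser`) is NEVER such a torus limit: in the limit states of
the symmetric finite-volume ground states, `d`-wave order can only appear as long-range order
(`IsTorusLimitOf.dWaveOrderParameterTT'_sq_le_re_boxAverage_of_unique_symmetric`) — Koma–Tasaki's
"symmetry breaking is invisible in the symmetric finite-volume states". [cite: KomaTasaki1994, §1] -/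
theorem InfVolFermionState.IsTorusLimitOf.expect_localPairAt_eq_zero {ω : InfVolFermionState 2}
    {ψ : ∀ L, Fock (Orb (FermionTorus 2 L))} {Ls : ℕ → ℕ} (h : ω.IsTorusLimitOf ψ Ls) {N : ℕ → ℕ}
    (hψ : ∀ j, IsNParticle (N j) (ψ (Ls j))) (S : Finset (Site 2)) (g : Site 2 → ℝ) (x : Site 2) :
    ω.expect (pairRegion S x) (localPairAt S g x) = 0 :=
  (h.isGaugeInvariant hψ).expect_localPairAt_eq_zero S g x

/-- … so a torus limit of fixed-particle-number GROUND-STATE vectors of `dWaveSourceTorusTT' L t' U μ 0` is a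
translation-invariant ground state of the pencil sitting at the CENTRE of the disc of pair amplitudes
(`image_expect_localPairAt_groundStates_eq_closedBall`), whatever the value of `m*`. [cite: KomaTasaki1994, §1] -/
theorem InfVolFermionState.IsTorusLimitOf.isMeanEnergyMinimiser_and_expect_localPairAt_eq_zero (t' U μ : ℝ)
    {ψ : ∀ L, Fock (Orb (FermionTorus 2 L))} {Ls : ℕ → ℕ} {N : ℕ → ℕ} {ω : InfVolFermionState 2}
    [∀ j, NeZero (Ls j)] (hω : ω.IsTorusLimitOf ψ Ls) (hLs : Tendsto Ls atTop atTop)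
    (hunit : ∀ j, star (ψ (Ls j)) ⬝ᵥ ψ (Ls j) = 1) (hN : ∀ j, IsNParticle (N j) (ψ (Ls j)))
    (hgs : ∀ j, dWaveSourceTorusTT' (Ls j) t' U μ 0 *ᵥ ψ (Ls j) =
      ((Matrix.groundEnergy (dWaveSourceTorusTT' (Ls j) t' U μ 0) : ℝ) : ℂ) • ψ (Ls j)) :
    ω.IsMeanEnergyMinimiser (hubbardTTPrimeMuInteraction 1 t' U μ) 1 ∧
      ω.expect (pairRegion (insert (0 : Site 2) unitSteps) 0)
        (localPairAt (insert 0 unitSteps) dWaveFormFactor 0) = 0 := by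
  have hmin := hω.isMeanEnergyMinimiser_sourced hLs hunit t' U μ 0 hgs
  rw [hubbardTTPrimeSourcedInteraction_zero_source] at hmin
  exact ⟨hmin, hω.expect_localPairAt_eq_zero hN _ _ 0⟩

end TorusLimitAmplitude

/-! ### The non-ergodicity corollary, unconditional (Bratteli–Robinson I Thm. 4.3.17 discharged in the tree) -/

section NotErgodic

/-- **`m⋆ > 0` ⇒ a gauge-invariant translation-invariant ground state of the `t–t'` pencil which is NOT
translation-ergodic — UNCONDITIONALLY**: the named fact `ergodic_pairCorr_boxAverage` (Bratteli–Robinson I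
Thm. 4.3.17: ergodic states have clustering box averages) fed to
`exists_gaugeInvariant_isMeanEnergyMinimiser_not_isErgodic_of_hasDWaveOrderTT'` is now the tree's theorem
`ergodic_pairCorr_boxAverage_holds` (hubbard-cq-lit-1, `ErgodicStatesODLROProofs.lean`). Its ergodic components
break the `U(1)` symmetry (Sewell 1970 §4). [cite: Sewell1970, §4] [cite: BratteliRobinsonI1987, Thm. 4.3.17] -/
theorem exists_gaugeInvariant_isMeanEnergyMinimiser_not_isErgodic_of_hasDWaveOrderTT'_unconditional
    {t' U μ : ℝ} (h : HasDWaveOrderTT' t' U μ) :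
    ∃ ω : InfVolFermionState 2, ω.IsMeanEnergyMinimiser (hubbardTTPrimeMuInteraction 1 t' U μ) 1 ∧
      ω.IsGaugeInvariant ∧ ¬ ω.IsErgodic :=
  exists_gaugeInvariant_isMeanEnergyMinimiser_not_isErgodic_of_hasDWaveOrderTT'
    InfVolFermionState.ergodic_pairCorr_boxAverage_holds h

/-- The `t' = 0` form: `HasDWaveOrder U μ` ⇒ a gauge-invariant, NON-ergodic translation-invariant ground state
of the grand-canonical Hubbard interaction. [cite: Sewell1970, §4] [cite: BratteliRobinsonI1987, Thm. 4.3.17] -/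
theorem exists_gaugeInvariant_isMeanEnergyMinimiser_not_isErgodic_of_hasDWaveOrder {U μ : ℝ}
    (h : HasDWaveOrder U μ) :
    ∃ ω : InfVolFermionState 2, ω.IsMeanEnergyMinimiser (hubbardTTPrimeMuInteraction 1 0 U μ) 1 ∧
      ω.IsGaugeInvariant ∧ ¬ ω.IsErgodic :=
  exists_gaugeInvariant_isMeanEnergyMinimiser_not_isErgodic_of_hasDWaveOrderTT'_unconditional
    ((hasDWaveOrderTT'_zero_iff U μ).2 h)

end NotErgodic

end Literature.MathematicalPhysics.QuantumLattice

end
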